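import Mathlib
import HarnessLib
import Summits.HubbardSuperconductivity.HubbardSuperconductivity.Theses.KLProgramme
import Summits.HubbardSuperconductivity.HubbardSuperconductivity.Theorems.KLProgrammeKLRegimeEngineV8DefsU12bG8
import Summits.HubbardSuperconductivity.HubbardSuperconductivity.Theorems.KLProgrammeKLRegimeEngineV8DefsG14
import Summits.HubbardSuperconductivity.HubbardSuperconductivity.Theorems.KLProgrammeKLRegimeEngineV17F2ClosersG
import Summits.HubbardSuperconductivity.HubbardSuperconductivity.Theorems.KLProgrammeKLRegimeEngineScaleZeroV17FRaiseGeo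
import Summits.HubbardSuperconductivity.HubbardSuperconductivity.Theorems.KLProgrammeKLRegimeEngineTwoLegStepV17F2ZeroCloserRaise
import Summits.HubbardSuperconductivity.HubbardSuperconductivity.Theorems.KLProgrammeKLRegimeEngineV8IsoMomentRow
import Summits.HubbardSuperconductivity.HubbardSuperconductivity.Theorems.KLProgrammeKLRegimeEngineScaleZeroLevelZeroFrame
import Summits.HubbardSuperconductivity.HubbardSuperconductivity.Theorems.KLProgrammeKLRegimeEngineKernelNormsWt4
import Summits.HubbardSuperconductivity.HubbardSuperconductivity.Theorems.KLProgrammeKLRegimeEngineV8DefsQ9c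
import Summits.HubbardSuperconductivity.HubbardSuperconductivity.Theorems.KLProgrammeKLRegimeSplitFlowPieceOscDefs
import Summits.HubbardSuperconductivity.HubbardSuperconductivity.Theorems.KLProgrammeKLRegimeTwoLegReadOscConsts

/-!
# K3 ENGINE (stmt-HubbardSuperconductivity-20437 `KLRegimeEngineV17F2`): the (a)/(M) CLOSERS and the (b) CLOSER-MODULO-PRODUCERS at the «A24∪A25∪Z» token
# `klEngU₀12G8 G P R c` — registrant PRESTAGE for VARIANT 1 of the rev-15 motion (plan g24 (R280); image 5ecf915a64ca6d5b); cell gate-hubbard-kl, seat gate-hubbard-kl-p1b g16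

WHAT.  `…EngineV17F2ClosersG` (p665440) closes (a)/(M)/(b)-modulo-producers at the A24 token `klEngU₀12G G`; VARIANT 1's token #14 is `klEngU₀12G8 G` (…DefsU12bG8 =
`klEngU₀12G ⊓ klCTu8T ⊓ klZspU5Z ⊓ klValU`), whose rows lift D3G's by name.  This file re-keys the three closers at `klEngU₀12G8` (proofs = p665440's with
`klEngU₀12G_le_* ↦ klEngU₀12G8_le_*`) and states the VARIANT-1 rows (a)/(M) verbatim as instances:
* §1 `stub_engine_scale0_G8` / `stub_twoLeg_scale0_G8`; §2 `stub_engine_step_norms_of_producers_G8 G hG hexT hexI hexG`;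
* §3 `…EngineV8.A24A25ZG14.stub_engine_scale0` (row 89b488fa104b) / `.stub_twoLeg_scale0` (row 8c878c8569f7).
NOT A MOTION and NOT a stub credit until the image is registered; producer statements are HYPOTHESES.  Bookkeeping compositions; nothing about the model is asserted;
nothing asserts (b), any open stub of 20437, K3 or superconductivity.
-/

noncomputable section

namespace Summit.HubbardSuperconductivity.HubbardSuperconductivity.Theorems.EngineV8

set_option linter.dupNamespace false -- summit = problem name (single-conjunct summit), D-0017

open Real Finset Literature.MathematicalPhysics.QuantumLattice Literature.Probability.LatticeModels
open Summit.HubbardSuperconductivity.HubbardSuperconductivity.Theorems.KLRegimeSplit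
open Summit.HubbardSuperconductivity.HubbardSuperconductivity.Theorems.KLProgrammeLegKernels
open Summit.HubbardSuperconductivity.HubbardSuperconductivity.Theorems.DispersionFlow

/-! ## §1 Stubs (a)/(M) at the token `klEngU₀12G8 G` -/

/-- **STUB (a) AT `(G, klEngQ9c P R, klEngC₃7G G, klEngU₀12G8 G)`** for any `G` with `initDevBar G = initDevBar klEngGeo8`, `klEngGeo8.cE4 ≤ G.cE4`, `klEngGeo8.CF ≤ G.CF`. -/
theorem stub_engine_scale0_G8 (G : GeoConsts) (hID : ∀ U : ℝ, initDevBar G U = initDevBar klEngGeo8 U) (hE4 : klEngGeo8.cE4 ≤ G.cE4)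
    (hCF : klEngGeo8.CF ≤ G.CF) :
    ∀ (P : SplitConsts) (R : RenConsts) (c : ℝ), P.WF → R.WF2 → 0 < c → c ≤ klEngC₃7G G P R →
      ∀ μ ∈ klWindowC, ∀ U : ℝ, 0 < U → U ≤ klEngU₀12G8 G P R c → ∀ β : ℝ, klBetaMin ≤ β → β ≤ Real.exp (c / U ^ 2) →
        ∀ (L M : ℕ) [NeZero L] [NeZero M], klEngL₄ P R β U ≤ L → klEngM₃ β U L ≤ M →
          FrameOK R U (nScales β) μ (klFlowFrameU L M β U μ 0) →
            KernelNormsV4 L M P (klEngQ9c P R) β U μ (klFlowFrameU L M β U μ 0) 0 ∧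
              PairLadderStepAtV17F2 L M G P (klEngQ9c P R) β U μ 0 ∧
                QuarticValueUVAtV17F L M G P (klEngQ9c P R) β U μ 0 ∧
                  EngineFirstMoments L M G P (klEngQ9c P R) β U μ (klFlowFrameU L M β U μ 0) 0 ∧
                    IsoTupleL1AtV17F L M G P β U μ 0 :=
  fun P R c hP hR hc hc3 μ hμ U hU hUle β hβ hβc L M _ _ hL hM hfr =>
    stub_engine_scale0_geo_of_klEng8 G hID hE4 hCF (fun P R => klEngQ9c P R) isRaiseOf_klEngQ9c_family P R c hP hR hc
      (hc3.trans (klEngC₃7G_le_klEngC₃6 G P R)) μ hμ U hU (hUle.trans (klEngU₀12G8_le_klEngU₀10 G P R c)) β hβ hβc L M hL hM hfr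

/-- **STUB (M) AT THE SAME TOKENS** for any `G` whose jet table dominates `klC4aJetC2`. -/
theorem stub_twoLeg_scale0_G8 (G : GeoConsts) (hS : ∀ k, klC4aJetC2 k ≤ G.S k) :
    ∀ (P : SplitConsts) (R : RenConsts) (c : ℝ), P.WF → R.WF2 → 0 < c → c ≤ klEngC₃7G G P R →
      ∀ μ ∈ klWindowC, ∀ U : ℝ, 0 < U → U ≤ klEngU₀12G8 G P R c → ∀ β : ℝ, klBetaMin ≤ β → β ≤ Real.exp (c / U ^ 2) →
        ∀ (L M : ℕ) [NeZero L] [NeZero M], klEngL₄ P R β U ≤ L → klEngM₃ β U L ≤ M →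
          FrameOK R U (nScales β) μ (klFlowFrameU L M β U μ 0) →
            EngineBoundsAtV17F2 L M G P (klEngQ9c P R) β U μ 0 →
              TwoLegReadJetBound L M klC4aJetC2 (klC4aJetC' P R) β U μ (klFlowFrameU L M β U μ 0) 0 →
                TwoLegStepV17F2 L M G P (klEngQ9c P R) R β U μ 0 :=
  fun P R c hP hR hc hc3 μ hμ U hU hUle β hβ hβc L M _ _ hL hM hfr hE hJ =>
    stub_twoLeg_scale0_raise_G G P R (klEngQ9c P R) (isRaiseOf_klEngQ9c P R) klC4aJetC2 hS c hP hR hc (hc3.trans (klEngC₃7G_le_klEngC₃6 G P R)) μ hμ U hU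
      (hUle.trans (klEngU₀12G8_le_klEngU₀10 G P R c)) β hβ hβc L M hL hM hfr hE hJ

/-! ## §2 Stub (b) at the token `klEngU₀12G8 G` from its three producers' ∃-statements AT `G` -/

/-- **STUB (b) AT `(G, klEngQ9c P R, klEngC₃7G G, klEngU₀12G8 G)` FROM ITS THREE PRODUCERS' ∃-STATEMENTS** (p665440's `…_of_producers_G` with the U-rows of `klEngU₀12G8`). -/
theorem stub_engine_step_norms_of_producers_G8 (G : GeoConsts) (hG : G.WF)
    (hexT : ∀ (P : SplitConsts) (R : RenConsts), P.WF → R.WF2 →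
      ∃ e : ℝ × (EngConsts → ℝ → ℝ) × ℝ, IsTowerPkgC e ∧ e.1 ≤ klEngQ9cCE P R ∧ TowerCoreStepV2 G P R (klEngQ8 P R) e.1 e.2.1 e.2.2)
    (hexI : ∃ Edu : ℝ × (SplitConsts → RenConsts → ℝ) × (GeoConsts → SplitConsts → RenConsts → EngConsts → ℝ → ℝ),
      0 ≤ Edu.1 ∧ (∀ P R, 0 ≤ Edu.2.1 P R) ∧ (∀ G P R Q cc, 0 < Edu.2.2 G P R Q cc) ∧ IsoMomFlowAt Edu.1 Edu.2.1 Edu.2.2)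
    (hexG : ∀ (P : SplitConsts) (R : RenConsts), P.WF → R.WF2 →
      ∃ e : (ℝ × ℝ × ℝ) × (EngConsts → ℝ → ℝ) × ℝ, IsGridLitPkg R e ∧ TwoLegGridMomentsStepCT P R (klEngQ7 P R) G e.1 e.2.1 e.2.2) :
    ∀ (P : SplitConsts) (R : RenConsts) (c : ℝ), P.WF → R.WF2 → 0 < c → c ≤ klEngC₃7G G P R →
      ∀ μ ∈ klWindowC, ∀ U : ℝ, 0 < U → U ≤ klEngU₀12G8 G P R c → ∀ β : ℝ, klBetaMin ≤ β → β ≤ Real.exp (c / U ^ 2) →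
        ∀ (L M : ℕ) [NeZero L] [NeZero M], klEngL₄ P R β U ≤ L → klEngM₃ β U L ≤ M →
          ∀ n : ℕ, 1 ≤ n → n ≤ nScales β + 1 → IsKLRegime U c (-(n : ℤ)) →
            HistP klPredsV17F2 L M G P (klEngQ9c P R) R β U μ 0 n →
              (∀ m, 1 ≤ m → m < n → FlowPieceOscAt L M (klReadOscC P R) β U μ m) →
              FrameOK R U (nScales β) μ (klFlowFrameU L M β U μ n) →
                (∀ j ≤ n, LevelsUExportMixedAt L M (klCU2 P R (klEngQ7 P R)) P β U μ j) →
                  KernelNormsV4 L M P (klEngQ9c P R) β U μ (klFlowFrameU L M β U μ n) n ∧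
                    (∀ j ≤ n, (KernelNormsLevels L M P (klEngQ9c P R) β U μ (klFlowFrameU L M β U μ n) j ∧
                      KernelNormsWt4 L M (klWtBudget P (klEngQ9c P R) U j) β U μ (klFlowFrameU L M β U μ n) j)) ∧
                    EngineFirstMoments L M G P (klEngQ9c P R) β U μ (klFlowFrameU L M β U μ n) n ∧
                    IsoFirstMomentsAt L M klIsoMomC (klIsoMomD P R) P β U μ n ∧
                    TwoLegGridFlowMomentsAtC L M (klZtG G P R) (klZs1G G P R) (klZs2G G P R) c β U μ n := by
  intro P R c hP hR hc hc3 μ hμ U hU hUle β hβ hβc L M _ _ hL hM n hn1 hn hreg hhist hosc hfr hlevU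
  have hc36 : c ≤ klEngC₃6 P R := hc3.trans (klEngC₃7G_le_klEngC₃6 G P R)
  have hU10 : U ≤ klEngU₀10 P R c := hUle.trans (klEngU₀12G8_le_klEngU₀10 G P R c)
  have hβ0 : 0 ≤ β := le_trans (by norm_num [klBetaMin]) hβ
  obtain ⟨hlev1, hE4⟩ := towerCoreC9G_at_klEngQ9c (hexT P R hP hR) hc hc36 (hc3.trans (klEngC₃7G_le_klTowerCoreCC9G G P R)) hμ hU hU10
    (hUle.trans (klEngU₀12G8_le_klTowerCoreUC9G G P R c)) hβ hβc hL hM hn1 hn hreg hhist hosc hfr hlevU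
  have h0 := levelZero_norms_frame_of_isRaiseOf_U10L4 P R (klEngQ9c P R) (isRaiseOf_klEngQ9c P R) c hP hR hc hc36 μ hμ U hU hU10 β hβ hβc
    (klFlowFrameU L M β U μ n) hfr L M hL hM
  have hlev : ∀ j ≤ n, KernelNormsLevels L M P (klEngQ9c P R) β U μ (klFlowFrameU L M β U μ n) j ∧
      KernelNormsWt4 L M (klWtBudget P (klEngQ9c P R) U j) β U μ (klFlowFrameU L M β U μ n) j := by
    intro j hj
    rcases Nat.eq_zero_or_pos j with rfl | hj1
    · exact ⟨h0.2.1, h0.2.2⟩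
    · exact hlev1 j hj1 hj
  have hV4 : KernelNormsV4 L M P (klEngQ9c P R) β U μ (klFlowFrameU L M β U μ n) n :=
    kernelNormsV4_of_kernelNormsWt4_klWtBudget hβ0 (hlev n le_rfl).2
  obtain ⟨⟨E, d, u⟩, hE0, hd, hu, hE⟩ := hexI
  have hiso := isoFirstMomentsAt_flow_klIsoMomPack hE0 hd hu hE G hG P R (klEngQ9c P R) c hP hR (klEngQ9c_wf P R) hc hc36 μ hμ
    U hU (hUle.trans (klEngU₀12G8_le_klIsoMomU G P R c)) β hβ hβc L M hL hM n hn1 hn hreg hhist hfr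
  have hgrid := twoLegGridFlowMomentsAtC_klZG_of_exists (hexG P R hP hR) (isRaiseOf_klEngQ9c P R) hc hc36 (hc3.trans (klEngC₃7G_le_klGridLitCAtG G P R)) hμ
    hU hU10 (hUle.trans (klEngU₀12G8_le_klGridLitUAtG G P R c)) hβ hβc hL hM hn1 hn hhist hfr hV4 hlev hlevU
  exact ⟨hV4, hlev, hE4, hiso, hgrid⟩

end Summit.HubbardSuperconductivity.HubbardSuperconductivity.Theorems.EngineV8

/-! ### VARIANT 1 «A24∪A25∪Z»-G14 (image 5ecf915a64ca6d5b): rows (a) 89b488fa104b / (M) 8c878c8569f7 verbatim -/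

namespace Summit.HubbardSuperconductivity.HubbardSuperconductivity.Theorems.EngineV8.A24A25ZG14

set_option linter.dupNamespace false -- summit = problem name (single-conjunct summit), D-0017

open Real Finset Literature.MathematicalPhysics.QuantumLattice Literature.Probability.LatticeModels
open Summit.HubbardSuperconductivity.HubbardSuperconductivity.Theorems.KLRegimeSplit
open Summit.HubbardSuperconductivity.HubbardSuperconductivity.Theorems.KLProgrammeLegKernels
open Summit.HubbardSuperconductivity.HubbardSuperconductivity.Theorems.DispersionFlow
open Summit.HubbardSuperconductivity.HubbardSuperconductivity.Theorems.EngineV8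

/-- VARIANT-1 candidate stub (a) (row 89b488fa104b), by `stub_engine_scale0_G8`. -/
theorem stub_engine_scale0 :
    ∀ (P : SplitConsts) (R : RenConsts) (c : ℝ), P.WF → R.WF2 → 0 < c → c ≤ klEngC₃7G klEngGeo14 P R →
      ∀ μ ∈ klWindowC, ∀ U : ℝ, 0 < U → U ≤ klEngU₀12G8 klEngGeo14 P R c → ∀ β : ℝ, klBetaMin ≤ β → β ≤ Real.exp (c / U ^ 2) →
        ∀ (L M : ℕ) [NeZero L] [NeZero M], klEngL₄ P R β U ≤ L → klEngM₃ β U L ≤ M →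
          FrameOK R U (nScales β) μ (klFlowFrameU L M β U μ 0) →
            KernelNormsV4 L M P (klEngQ9c P R) β U μ (klFlowFrameU L M β U μ 0) 0 ∧
              PairLadderStepAtV17F2 L M klEngGeo14 P (klEngQ9c P R) β U μ 0 ∧
                QuarticValueUVAtV17F L M klEngGeo14 P (klEngQ9c P R) β U μ 0 ∧
                  EngineFirstMoments L M klEngGeo14 P (klEngQ9c P R) β U μ (klFlowFrameU L M β U μ 0) 0 ∧
                    IsoTupleL1AtV17F L M klEngGeo14 P β U μ 0 :=
  stub_engine_scale0_G8 klEngGeo14 initDevBar_klEngGeo14 klEngGeo8_cE4_le_klEngGeo14_cE4 klEngGeo8_CF_le_klEngGeo14_CF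

/-- VARIANT-1 candidate stub (M) (row 8c878c8569f7), by `stub_twoLeg_scale0_G8`. -/
theorem stub_twoLeg_scale0 :
    ∀ (P : SplitConsts) (R : RenConsts) (c : ℝ), P.WF → R.WF2 → 0 < c → c ≤ klEngC₃7G klEngGeo14 P R →
      ∀ μ ∈ klWindowC, ∀ U : ℝ, 0 < U → U ≤ klEngU₀12G8 klEngGeo14 P R c → ∀ β : ℝ, klBetaMin ≤ β → β ≤ Real.exp (c / U ^ 2) →
        ∀ (L M : ℕ) [NeZero L] [NeZero M], klEngL₄ P R β U ≤ L → klEngM₃ β U L ≤ M →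
          FrameOK R U (nScales β) μ (klFlowFrameU L M β U μ 0) →
            EngineBoundsAtV17F2 L M klEngGeo14 P (klEngQ9c P R) β U μ 0 →
              TwoLegReadJetBound L M klC4aJetC2 (klC4aJetC' P R) β U μ (klFlowFrameU L M β U μ 0) 0 →
                TwoLegStepV17F2 L M klEngGeo14 P (klEngQ9c P R) R β U μ 0 :=
  stub_twoLeg_scale0_G8 klEngGeo14 klC4aJetC2_le_klEngGeo14_S

end Summit.HubbardSuperconductivity.HubbardSuperconductivity.Theorems.EngineV8.A24A25ZG14


/-! ### APPENDED (registrant p1b g16, after the r16 V1 REGISTRATION e71fc5a7a1737442, pen (R334)): stub (b) AT THE REGISTERED ROW modulo its three producers — and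
this resubmission WITHOUT `--as helper` lets the gate record §3's `A24A25ZG14.stub_engine_scale0/_twoLeg_scale0` (rows 89b488fa104b / 8c878c8569f7) as the (a)/(M) STUB CREDITS. -/

namespace Summit.HubbardSuperconductivity.HubbardSuperconductivity.Theorems.EngineV8.A24A25ZG14

set_option linter.dupNamespace false -- summit = problem name (single-conjunct summit), D-0017

open Real Finset Literature.MathematicalPhysics.QuantumLattice Literature.Probability.LatticeModels
open Summit.HubbardSuperconductivity.HubbardSuperconductivity.Theorems.KLRegimeSplit
open Summit.HubbardSuperconductivity.HubbardSuperconductivity.Theorems.KLProgrammeLegKernels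
open Summit.HubbardSuperconductivity.HubbardSuperconductivity.Theorems.DispersionFlow
open Summit.HubbardSuperconductivity.HubbardSuperconductivity.Theorems.EngineV8

/-- **STUB (b) OF THE rev-16 V1 REGISTRATION (row 2c2ad3b44ff7) FROM ITS THREE PRODUCERS' ∃-STATEMENTS AT `klEngGeo14`** (hypotheses; the (b) analogue of p662084 for
the new registration): `stub_engine_step_norms_of_producers_G8 klEngGeo14 klEngGeo14_wf`. -/
theorem stub_engine_step_norms_of_producers
    (hexT : ∀ (P : SplitConsts) (R : RenConsts), P.WF → R.WF2 →
      ∃ e : ℝ × (EngConsts → ℝ → ℝ) × ℝ, IsTowerPkgC e ∧ e.1 ≤ klEngQ9cCE P R ∧ TowerCoreStepV2 klEngGeo14 P R (klEngQ8 P R) e.1 e.2.1 e.2.2)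
    (hexI : ∃ Edu : ℝ × (SplitConsts → RenConsts → ℝ) × (GeoConsts → SplitConsts → RenConsts → EngConsts → ℝ → ℝ),
      0 ≤ Edu.1 ∧ (∀ P R, 0 ≤ Edu.2.1 P R) ∧ (∀ G P R Q cc, 0 < Edu.2.2 G P R Q cc) ∧ IsoMomFlowAt Edu.1 Edu.2.1 Edu.2.2)
    (hexG : ∀ (P : SplitConsts) (R : RenConsts), P.WF → R.WF2 →
      ∃ e : (ℝ × ℝ × ℝ) × (EngConsts → ℝ → ℝ) × ℝ, IsGridLitPkg R e ∧ TwoLegGridMomentsStepCT P R (klEngQ7 P R) klEngGeo14 e.1 e.2.1 e.2.2) :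
    ∀ (P : SplitConsts) (R : RenConsts) (c : ℝ), P.WF → R.WF2 → 0 < c → c ≤ klEngC₃7G klEngGeo14 P R →
      ∀ μ ∈ klWindowC, ∀ U : ℝ, 0 < U → U ≤ klEngU₀12G8 klEngGeo14 P R c → ∀ β : ℝ, klBetaMin ≤ β → β ≤ Real.exp (c / U ^ 2) →
        ∀ (L M : ℕ) [NeZero L] [NeZero M], klEngL₄ P R β U ≤ L → klEngM₃ β U L ≤ M →
          ∀ n : ℕ, 1 ≤ n → n ≤ nScales β + 1 → IsKLRegime U c (-(n : ℤ)) →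
            HistP klPredsV17F2 L M klEngGeo14 P (klEngQ9c P R) R β U μ 0 n →
              (∀ m, 1 ≤ m → m < n → FlowPieceOscAt L M (klReadOscC P R) β U μ m) →
              FrameOK R U (nScales β) μ (klFlowFrameU L M β U μ n) →
                (∀ j ≤ n, LevelsUExportMixedAt L M (klCU2 P R (klEngQ7 P R)) P β U μ j) →
                  KernelNormsV4 L M P (klEngQ9c P R) β U μ (klFlowFrameU L M β U μ n) n ∧
                    (∀ j ≤ n, (KernelNormsLevels L M P (klEngQ9c P R) β U μ (klFlowFrameU L M β U μ n) j ∧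
                      KernelNormsWt4 L M (klWtBudget P (klEngQ9c P R) U j) β U μ (klFlowFrameU L M β U μ n) j)) ∧
                    EngineFirstMoments L M klEngGeo14 P (klEngQ9c P R) β U μ (klFlowFrameU L M β U μ n) n ∧
                    IsoFirstMomentsAt L M klIsoMomC (klIsoMomD P R) P β U μ n ∧
                    TwoLegGridFlowMomentsAtC L M (klZtG klEngGeo14 P R) (klZs1G klEngGeo14 P R) (klZs2G klEngGeo14 P R) c β U μ n :=
  stub_engine_step_norms_of_producers_G8 klEngGeo14 klEngGeo14_wf hexT hexI hexG

end Summit.HubbardSuperconductivity.HubbardSuperconductivity.Theorems.EngineV8.A24A25ZG14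

end
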